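import Literature.AlgebraicGeometry.RelativeSpec.EquivariantComplexDescent
import Literature.AlgebraicGeometry.Motives.AbelianVarietyIsogenyGeometricQuotient
import HarnessLib

/-!
# Descent of an equivariant complex of quasi-coherent modules along a complex isogeny

Layer `Literature/AlgebraicGeometry/Motives`, namespace `Literature.AlgebraicGeometry.Motives.AbelianVariety`.
For an isogeny `f : A → B` of COMPLEX abelian varieties with kernel `Δ = Ker f(ℂ)` acting on `A` by
translations (`kerTranslationActionOver f : ActionOver f Δ`, `(ρ.aut x).hom = t_x` — `Motives/AbelianVarietyTranslationAction`),
the tree proves that `f` is an AFFINE GEOMETRIC QUOTIENT of `A` by `Δ`, FREE on every affine chart `f⁻¹V`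
(`Motives/AbelianVarietyIsogenyGeometricQuotient`: `isGeometricQuotient_kerTranslationActionOver`,
`isAffineHom_of_isIsogeny`, `kerTranslationActionOver_free` — Mumford, *Abelian Varieties* §7 Thm. 4 is a
THEOREM there, by recognition). These are literally the hypotheses of the descent theorems of
`RelativeSpec/EquivariantModuleDescent` (one module) and `RelativeSpec/EquivariantComplexDescent`
(complexes, functorially), so this file only DISCHARGES them:

* `kerPointsFintype f hf` — the `Fintype` structure on `Ker f(ℂ)` (a `def`, bind with `letI`; the descended
  complex is a kernel of a product indexed by `Δ`);
* **`isIso_descentHomComplex_kerTranslation`** — for a complex `K` of quasi-coherent `𝒪_A`-modules with a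
  `Δ`-equivariant structure `Φ` (`ActionOver.EquivariantComplexStructure`: termwise linearisations
  `t_x^* Kⁱ ≅ Kⁱ` with unit ∕ cocycle, commuting with `d`), the comparison
  `f^*• (f_*• K)^Δ ⟶ K` is an ISOMORPHISM OF COMPLEXES; **`isogenyPullbackDescendComplexIso`** — the
  isomorphism `f^*• (descendComplex K Φ) ≅ K`; `quasiIso_descentHomComplex_kerTranslation`;
* **`isBoundedVBComplex_descendComplex_kerTranslation`** — a bounded complex of `Δ`-linearised vector bundles on
  `A` descends to a bounded complex of vector bundles on `B`; the print-shaped existence statement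
  **`exists_isBoundedVBComplex_pullback_iso_of_equivariant`**: `∃ L` bounded VB on `B` with `f^*• L ≅ K`.

Mumford §12 Thm. 1 («if `K` acts freely, `π^*` is an equivalence `Qcoh(X/K) ≃ Qcoh^K(X)`») for complexes and
their differentials along `X → X/K = B`. Everything is proved; 0 named facts; no instance (the `Fintype` is a
`def`), no notation. Typed for the cell `pub-hodge-ring2` (plate (M5) of crux 26512: the descent shape along the
secant quotient `q : J × Ĵ → Y`); a research route conditional on HC_CM, not a corollary — nothing here refers to it.

## References

* [MumfordAV1970] D. Mumford, *Abelian Varieties* (1970), §7 Thm. 4 (p. 72), §12 Thm. 1 (p. 112).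
* [MumfordFogartyKirwan1994] D. Mumford, J. Fogarty, F. Kirwan, *GIT*, 3rd ed., Ch. 1 §3, Prop. 7.1.
* [SGA1] SGA 1, Exp. VIII Thm. 1.1, Prop. 1.10.
-/

noncomputable section

-- `TopCat.Presheaf`/`Scheme.Modules` are not reducible (as in Mathlib's `AlgebraicGeometry/Modules`).
set_option backward.isDefEq.respectTransparency false

universe u

open CategoryTheory CategoryTheory.Limits AlgebraicGeometry
open Literature.AlgebraicGeometry.RelativeSpec Literature.AlgebraicGeometry.KTheory

namespace Literature.AlgebraicGeometry.Motives

namespace AbelianVariety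

variable {A B : AbelianVariety ℂ} (f : A ⟶ B)

/-- The `Fintype` structure on the kernel `Ker f(ℂ)` of an isogeny (finite: `finite_kerPoints_of_isFinite`).
A `def`, not an instance: bind with `letI := kerPointsFintype f hf`. [cite: MumfordAV1970, §7 Thm. 4 (p. 72)] -/
@[reducible]
def kerPointsFintype (hf : IsIsogeny f) : Fintype ↥(Hom.kerPoints (specOver ℂ ℂ) f) :=
  haveI := hf.2
  haveI : Finite ↥(Hom.kerPoints (specOver ℂ ℂ) f) := finite_kerPoints_of_isFinite f ℂ
  Fintype.ofFinite _

variable [Fintype ↥(Hom.kerPoints (specOver ℂ ℂ) f)] {κ : Type*} {c : ComplexShape κ}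

/-- **Descent of an equivariant complex along an isogeny: `f^*• (f_*• K)^Δ ⟶ K` is an isomorphism of
complexes** for every complex `K` of quasi-coherent `𝒪_A`-modules with a `Ker f(ℂ)`-equivariant structure
`Φ` (the isogeny is a free affine geometric quotient; `ActionOver.isIso_descentHomComplex`).
[cite: MumfordAV1970, §7 Thm. 4 (p. 72) and §12 Thm. 1 (p. 112)] -/
theorem isIso_descentHomComplex_kerTranslation (hf : IsIsogeny f) (K : HomologicalComplex A.X.left.Modules c)
    (Φ : (kerTranslationActionOver f).EquivariantComplexStructure K) [∀ i, (K.X i).IsQuasicoherent] :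
    IsIso ((kerTranslationActionOver f).descentHomComplex K Φ) :=
  haveI := isAffineHom_of_isIsogeny f hf
  (kerTranslationActionOver f).isIso_descentHomComplex K Φ (isGeometricQuotient_kerTranslationActionOver f hf)
    (kerTranslationActionOver_free f hf)

/-- **`f^*• (descendComplex K Φ) ≅ K`**: the descended complex `(f_*• K)^Δ` on `B` pulls back to the given
equivariant complex on `A` (as complexes). [cite: MumfordAV1970, §12 Thm. 1 (p. 112)] -/
def isogenyPullbackDescendComplexIso (hf : IsIsogeny f) (K : HomologicalComplex A.X.left.Modules c)
    (Φ : (kerTranslationActionOver f).EquivariantComplexStructure K) [∀ i, (K.X i).IsQuasicoherent] :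
    ((Scheme.Modules.pullback (Hom.toSchemeHom f)).mapHomologicalComplex c).obj
        ((kerTranslationActionOver f).descendComplex K Φ) ≅ K :=
  haveI := isIso_descentHomComplex_kerTranslation f hf K Φ
  asIso ((kerTranslationActionOver f).descentHomComplex K Φ)

/-- The underlying chain map of `isogenyPullbackDescendComplexIso` is the termwise comparison `descentHom`
(definitional). [cite: MumfordAV1970, §12 Thm. 1 (p. 112)] -/
theorem isogenyPullbackDescendComplexIso_hom_f (hf : IsIsogeny f) (K : HomologicalComplex A.X.left.Modules c)
    (Φ : (kerTranslationActionOver f).EquivariantComplexStructure K) [∀ i, (K.X i).IsQuasicoherent] (i : κ) :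
    (isogenyPullbackDescendComplexIso f hf K Φ).hom.f i = (kerTranslationActionOver f).descentHom (K.X i) (Φ.term i).iso :=
  rfl

/-- The comparison is in particular a quasi-isomorphism (cochain complexes indexed by `ℤ`). [cite: MumfordAV1970, §12 Thm. 1 (p. 112)] -/
theorem quasiIso_descentHomComplex_kerTranslation (hf : IsIsogeny f) (K : CochainComplex A.X.left.Modules ℤ)
    (Φ : (kerTranslationActionOver f).EquivariantComplexStructure K) [∀ i, (K.X i).IsQuasicoherent] :
    QuasiIso ((kerTranslationActionOver f).descentHomComplex K Φ) :=
  haveI := isIso_descentHomComplex_kerTranslation f hf K Φ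
  inferInstance

/-- The `Ker f(ℂ)`-equivariant structure transported to the pull-back is the canonical one: the comparison
intertwines `EquivariantComplexStructure.ofPullback` with `Φ` in every degree (`((kerTranslationActionOver f).aut x).hom`
is the translation `(t_x).left` by `kerTranslationActionOver_aut_hom`, `rfl`). [cite: MumfordAV1970, §12 Thm. 1 (p. 112)] -/
theorem pullback_map_isogenyPullbackDescendComplexIso_hom_f_comp (hf : IsIsogeny f)
    (K : HomologicalComplex A.X.left.Modules c) (Φ : (kerTranslationActionOver f).EquivariantComplexStructure K)
    [∀ i, (K.X i).IsQuasicoherent] (x : Hom.kerPoints (specOver ℂ ℂ) f) (i : κ) :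
    (Scheme.Modules.pullback ((kerTranslationActionOver f).aut x).hom).map ((isogenyPullbackDescendComplexIso f hf K Φ).hom.f i) ≫
        ((Φ.term i).iso x).hom =
      (((ActionOver.EquivariantComplexStructure.ofPullback ((kerTranslationActionOver f).descendComplex K Φ)).term i).iso x).hom ≫
        (isogenyPullbackDescendComplexIso f hf K Φ).hom.f i :=
  (kerTranslationActionOver f).pullback_map_descentHomComplex_f_comp K Φ x i

/-- **A bounded complex of `Ker f(ℂ)`-linearised vector bundles on `A` descends to a bounded complex of vector
bundles on `B`.** [cite: SGA1, Exp. VIII Prop. 1.10] [cite: MumfordAV1970, §12 Thm. 1 (p. 112)] -/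
theorem isBoundedVBComplex_descendComplex_kerTranslation (hf : IsIsogeny f) (K : CochainComplex A.X.left.Modules ℤ)
    (Φ : (kerTranslationActionOver f).EquivariantComplexStructure K) (hK : IsBoundedVBComplex K) :
    IsBoundedVBComplex ((kerTranslationActionOver f).descendComplex K Φ) :=
  haveI := isAffineHom_of_isIsogeny f hf
  (kerTranslationActionOver f).isBoundedVBComplex_descendComplex (isGeometricQuotient_kerTranslationActionOver f hf)
    (kerTranslationActionOver_free f hf) K Φ hK

omit [Fintype ↥(Hom.kerPoints (specOver ℂ ℂ) f)] in
/-- **Print-shaped existence**: a bounded complex of vector bundles on `A` with a `Ker f(ℂ)`-equivariant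
structure is the pull-back of a bounded complex of vector bundles on `B` (as complexes, hence up to
quasi-isomorphism). [cite: MumfordAV1970, §7 Thm. 4 (p. 72) and §12 Thm. 1 (p. 112)] -/
theorem exists_isBoundedVBComplex_pullback_iso_of_equivariant (hf : IsIsogeny f) (K : CochainComplex A.X.left.Modules ℤ)
    (Φ : (kerTranslationActionOver f).EquivariantComplexStructure K) (hK : IsBoundedVBComplex K) :
    ∃ L : CochainComplex B.X.left.Modules ℤ, IsBoundedVBComplex L ∧
      Nonempty (((Scheme.Modules.pullback (Hom.toSchemeHom f)).mapHomologicalComplex (ComplexShape.up ℤ)).obj L ≅ K) := by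
  letI := kerPointsFintype f hf
  haveI : ∀ i, SheafOfModules.IsLocallyFree (K.X i) := fun i => (hK.isFiniteLocallyFree i).isVectorBundle.1
  exact ⟨_, isBoundedVBComplex_descendComplex_kerTranslation f hf K Φ hK, ⟨isogenyPullbackDescendComplexIso f hf K Φ⟩⟩

end AbelianVariety

end Literature.AlgebraicGeometry.Motives

end
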